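/-
Copyright (c) 2026. All rights reserved.
Released under Apache 2.0 license as described in the file LICENSE.
-/
import Literature.NumberTheory.ComplexMultiplication.CMTypeTwoPowerCharacterWeilType
import Literature.AlgebraicGeometry.Pohlmann1968.WeilTypeCMSubfieldExceptionalClasses
import HarnessLib

/-!
# Yanai 2015, Theorem 4.1 for abelian CM fields: an odd Galois character of 2-power order vanishing on the CM type
# makes `(K; Φ)` of Weil type over the fixed field of its kernel — a PROPER CM subfield — and puts an exceptional
# Hodge class on every realisation (index of degeneracy `1`)

Number-field dress of `NumberTheory/ComplexMultiplication/CMTypeTwoPowerCharacterWeilType` (THEOREM 4.1 of H. Yanai,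
*On the index of degeneracy of a CM abelian variety*, JTNB **27** (2015) 815–820 [Yanai2015IndexDegeneracy], proved
there at group level) on the carriers of `Pohlmann1968/CMTypeRankCharactersNumberField` (`Φ : CMType K`, the
embeddings `σ_g = φ₀ ∘ g⁻¹ = embOf φ₀ g` indexed by `Gal(K/ℚ)`, characters `χ : AddChar (Additive Gal(K/ℚ)) ℂ`) and of
`Pohlmann1968/WeilTypeCMSubfieldExceptionalClasses` (a type BALANCED over a subfield `j : k → K`: over every
`τ : k → ℂ` as many extensions in `Φ` as outside — "`(A, k)` is of Weil type").

The print (p. 818): "THEOREM 4.1. Let `A` be a CM abelian variety of dimension `d` as in Section 3 [`K` abelian over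
`ℚ`, `A` simple of type `(K, S)`]. Assume that there exists an odd character `χ` of `G = Gal(K/ℚ)` with `χ(S) = 0`
and the order of `χ` (`= 2t`) is a power of `2`. Then `A` is of Weil type; the index of degeneracy of `A` is equal to
`1`. Proof. … Let `H` be the kernel of `χ` and `k` be the subfield of `K` corresponding to `H` … This implies
`n_i = n_{t+i}` … So `k` is a proper CM subfield of `K` and `A` is of Weil type with respect to `k`; the index of
degeneracy of `A` is equal to `1`."  (§2, p. 817: "there exists an exceptional Hodge cycle of codimension `r/2` …
In particular, the index of degeneracy of `A` is equal to `1`", `r = #H = [K : k]`.)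

## Setting

`K` a number field, normal over `ℚ` with COMMUTATIVE Galois group (hypothesis `hcomm`, as in the dictionary file),
`Φ : CMType K`, `φ₀ : K →+* ℂ` a base embedding, `ρ ∈ Gal(K/ℚ)` the complex conjugation (`φ₀ ∘ ρ = conj ∘ φ₀`),
`χ` a character of `Gal(K/ℚ)` with `χ(ρ) = −1`, `χ(g)^{2^s} = 1` for all `g`, and `Σ_{g : σ_g ∈ Φ} χ(g) = 0`;
`H ≤ Gal(K/ℚ)` its kernel (hypothesis `hH : g ∈ H ↔ χ(g) = 1`), `k = K^H = IntermediateField.fixedField H` and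
`j = algebraMap k K` the inclusion.

## What is proved (theorems only; no definition, no named fact, no `sorry`)

* `embOf_comp_algebraMap_fixedField_eq_iff` — the Galois correspondence step: `σ_g|_k = σ_{g₁}|_k ⟺ g₁g⁻¹ ∈ H`
  (`fixingSubgroup (fixedField H) = H`), i.e. the fibres of `Hom(K, ℂ) → Hom(k, ℂ)` are the cosets `Hγ^i`.
* `fibres_balanced_fixedField_of_oddCharacter_pow_two_pow` — **"`A` is of Weil type with respect to `k`"**: over
  every `τ : k →+* ℂ`, `#{φ | φ|_k = τ, φ ∈ Φ} = #{φ | φ|_k = τ, φ ∉ Φ}` (the `hW` hypothesis of the Weil-type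
  companion), from the group-level `IsCMTypeWith.two_mul_card_filter_char_eq`.
* `fixedField_ne_top_of_oddCharacter_pow_two_pow`, `two_dvd_finrank_fixedField_of_oddCharacter_pow_two_pow`,
  `conjugate_comp_algebraMap_fixedField_ne` — **"`k` is a proper CM subfield of `K`"**: `k ≠ K`, `[K : k] = #H` is
  even, and complex conjugation is non-trivial on `k` (`ρ ∉ H`).
* `not_isNondegenerate_of_oddCharacter_pow_two_pow` — `(K; Φ)` is degenerate (also Kubota directly);
  `exists_exceptional_of_oddCharacter_pow_two_pow` — **"the index of degeneracy of `A` is equal to `1`"**: for `Φ`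
  PRIMITIVE (`A` simple, Yanai §3) EVERY realisation `(A, ι, θ)` of `(K; Φ)` carries a rational `(m, m)`-class outside
  `Dᵐ(A) ⊗ ℂ` with `2m = [K : k]` — the Weil class of `(A, k)`, by the companion's Mumford–Pohlmann mechanism
  `exists_exceptional_of_fibres_balanced'`.

NOT here: §5 (the CM Jacobians of Tautz–Top–Verberkmoes); `k` packaged as a `NumberField.IsCMField` instance (the
tree's typer rule forbids new instances in statement files — the non-reality of the place `φ₀|_k` is what is proved
and used).

## Relation to the Summit-side files `Summits/HodgeConjecture/CorCM/AbelianTwoPowerCMTypes{,WeilType}.lean`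

Those files (cell seat b04, 2026-08-21; namespace `Summit.HodgeConjecture.CorCM.AbelianTwoPower`) prove, for abelian
CM fields of 2-POWER DEGREE `[K:ℚ] = 2^{n+1}`, "degenerate ⟺ equidistributed over some odd character ⟺ balanced over
some `K^{ker χ}`" and the exceptional class on `A` itself, citing Kubota / Gordon / Dodson / Shimura and describing
the direction ⟹ as "the converse of Yanai's criterion" (Yanai 1994 = Gordon [B.140]).  That direction IS the
published THEOREM 4.1 of Yanai 2015 — stated there for EVERY abelian CM field, with the 2-power hypothesis on the ORDER
OF `χ` rather than on `[K:ℚ]`: `AbelianTwoPower.equidistributed_of_sum_eq_zero` is the group-level companion's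
`card_filter_char_eq_card_filter_char_eq_neg_of_pow_two_pow`, `AbelianTwoPower.embOf_comp_eq_iff` prints like
`embOf_comp_algebraMap_fixedField_eq_iff` below, and `AbelianTwoPower.fibres_balanced_of_equidistributed` corresponds to
`fibres_balanced_fixedField_of_oddCharacter_pow_two_pow`.  Literature files cannot import `Summits/` (D-0017), whence
the statements here, on Literature carriers and with the published attribution [Yanai2015IndexDegeneracy].

## References

* [Yanai2015IndexDegeneracy] H. Yanai, JTNB 27 (2015) 815–820, Thm. 4.1 (p. 818), §2 (p. 816–817).
* [Gordon1999HodgeAVSurvey] B. B. Gordon, *A survey of the Hodge conjecture for abelian varieties*, 9.2.2, 5.13 (ii).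
* [Pohlmann1968] H. Pohlmann, Ann. of Math. 88 (1968), Thm. 1 (tree `exists_exceptional_iff`).

## Provenance

Cell `pub-hodgecm2` (COR-CM), literature seat `lit-deligne-3` gen 47 (claim YANAI-TWO-POWER-NF; count-neutral).
-/

noncomputable section

open CategoryTheory NumberField

namespace Literature.AlgebraicGeometry.Pohlmann1968

open Literature.NumberTheory.ComplexMultiplication
open Literature.AlgebraicGeometry.Motives (AbelianVariety CMType)
open Literature.AlgebraicGeometry.HodgeTheory
open Literature.AlgebraicGeometry.ComplexMultiplication (IsCMTypeRealisation)
open Literature.Barriers.HodgeConjecture (divisorClassesSpan)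

open scoped Classical

section Galois

variable {K : Type} [Field K] [NumberField K]

/-- `χ(g) ≠ 0` for a character of a finite group. [folklore] -/
private theorem char_apply_ne_zero (χ : AddChar (Additive (K ≃ₐ[ℚ] K)) ℂ) (g : K ≃ₐ[ℚ] K) :
    χ (Additive.ofMul g) ≠ 0 := fun h0 => by
  have h1 : χ (Additive.ofMul g) * χ (-Additive.ofMul g) = 1 := by
    rw [← AddChar.map_add_eq_mul, add_neg_cancel, AddChar.map_zero_eq_one]
  rw [h0, zero_mul] at h1
  exact zero_ne_one h1

/-- **The fibres of `Hom(K, ℂ) → Hom(K^H, ℂ)` are the cosets of `H`** (Galois correspondence,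
`fixingSubgroup (fixedField H) = H`): `σ_g|_{K^H} = σ_{g₁}|_{K^H} ⟺ g₁g⁻¹ ∈ H` — "Let `G = ⋃ Hγ^i` be the coset
decomposition of `G` by `H` … `τ ∈ Gal(k/ℚ)` is corresponding to `Hγ^i`". [cite: Yanai2015IndexDegeneracy, Thm. 4.1 (proof, p. 818)] -/
theorem embOf_comp_algebraMap_fixedField_eq_iff (φ₀ : K →+* ℂ) (H : Subgroup (K ≃ₐ[ℚ] K)) (g g₁ : K ≃ₐ[ℚ] K) :
    (embOf φ₀ g).comp (algebraMap (IntermediateField.fixedField H) K) =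
        (embOf φ₀ g₁).comp (algebraMap (IntermediateField.fixedField H) K) ↔ g₁ * g⁻¹ ∈ H := by
  have hH : g₁ * g⁻¹ ∈ H ↔ ∀ x ∈ IntermediateField.fixedField H, (g₁ * g⁻¹) x = x := by
    rw [← IntermediateField.mem_fixingSubgroup_iff, IntermediateField.fixingSubgroup_fixedField]
  rw [hH]
  constructor
  · intro h x hx
    have h1 := RingHom.congr_fun h ⟨x, hx⟩
    simp only [RingHom.comp_apply, IntermediateField.algebraMap_apply, embOf_apply] at h1
    have h2 : g.symm x = g₁.symm x := φ₀.injective h1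
    rw [AlgEquiv.mul_apply, AlgEquiv.aut_inv, h2, AlgEquiv.apply_symm_apply]
  · intro h
    refine RingHom.ext fun x => ?_
    simp only [RingHom.comp_apply, IntermediateField.algebraMap_apply, embOf_apply]
    have h1 := h (x : K) x.2
    rw [AlgEquiv.mul_apply, AlgEquiv.aut_inv] at h1
    -- `g₁ (g⁻¹ x) = x ⟹ g⁻¹ x = g₁⁻¹ x`
    have h2 : g.symm (x : K) = g₁.symm (x : K) := by
      have := congrArg g₁.symm h1
      rwa [AlgEquiv.symm_apply_apply] at this
    rw [h2]

/-- With `H = ker χ`: `σ_g|_k = σ_{g₁}|_k ⟺ χ(g) = χ(g₁)`, `k = K^H`. [cite: Yanai2015IndexDegeneracy, Thm. 4.1 (proof, p. 818)] -/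
theorem embOf_comp_algebraMap_fixedField_eq_iff_char_eq (φ₀ : K →+* ℂ) {χ : AddChar (Additive (K ≃ₐ[ℚ] K)) ℂ}
    (H : Subgroup (K ≃ₐ[ℚ] K)) (hH : ∀ g, g ∈ H ↔ χ (Additive.ofMul g) = 1) (g g₁ : K ≃ₐ[ℚ] K) :
    (embOf φ₀ g).comp (algebraMap (IntermediateField.fixedField H) K) =
        (embOf φ₀ g₁).comp (algebraMap (IntermediateField.fixedField H) K) ↔
      χ (Additive.ofMul g) = χ (Additive.ofMul g₁) := by
  rw [embOf_comp_algebraMap_fixedField_eq_iff, hH, ofMul_mul, ofMul_inv, AddChar.map_add_eq_mul,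
    AddChar.map_neg_eq_inv, mul_inv_eq_one₀ (char_apply_ne_zero χ g)]
  exact eq_comm

end Galois

/-! ### Theorem 4.1 on the number-field carriers -/

section Yanai

variable {K : Type} [Field K] [NumberField K] [Normal ℚ K]

/-- **THEOREM 4.1 — "`A` is of Weil type with respect to `k`"** (`k = K^{ker χ}`): for an abelian CM field `K`
(normal, `Gal(K/ℚ)` commutative), a CM type `Φ`, and an ODD character `χ` of `Gal(K/ℚ)` of 2-power order VANISHING on
`{g | σ_g ∈ Φ}`, the type `Φ` is BALANCED over `k`: over every complex embedding `τ` of `k`, as many extensions of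
`τ` to `K` lie in `Φ` as outside it (`n_τ = r/2`). [cite: Yanai2015IndexDegeneracy, Thm. 4.1] -/
theorem fibres_balanced_fixedField_of_oddCharacter_pow_two_pow
    (hcomm : ∀ g h : K ≃ₐ[ℚ] K, g * h = h * g) (Φ : CMType K) (φ₀ : K →+* ℂ) (ρ : K ≃ₐ[ℚ] K)
    (hρ : ∀ x, φ₀ (ρ x) = starRingEnd ℂ (φ₀ x)) {χ : AddChar (Additive (K ≃ₐ[ℚ] K)) ℂ} {s : ℕ}
    (hodd : χ (Additive.ofMul ρ) = -1) (hχ : ∀ g : K ≃ₐ[ℚ] K, χ (Additive.ofMul g) ^ 2 ^ s = 1)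
    (hvan : ∑ g ∈ Finset.univ.filter (fun g : K ≃ₐ[ℚ] K => embOf φ₀ g ∈ Φ.1), χ (Additive.ofMul g) = 0)
    (H : Subgroup (K ≃ₐ[ℚ] K)) (hH : ∀ g, g ∈ H ↔ χ (Additive.ofMul g) = 1) :
    ∀ τ : IntermediateField.fixedField H →+* ℂ,
      {φ : K →+* ℂ | φ.comp (algebraMap (IntermediateField.fixedField H) K) = τ ∧ φ ∈ Φ.1}.ncard =
        {φ : K →+* ℂ | φ.comp (algebraMap (IntermediateField.fixedField H) K) = τ ∧ φ ∉ Φ.1}.ncard := by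
  letI : CommGroup (K ≃ₐ[ℚ] K) := { (inferInstance : Group (K ≃ₐ[ℚ] K)) with mul_comm := hcomm }
  intro τ
  set j := algebraMap (IntermediateField.fixedField H) K with hjdef
  by_cases hτ : ∃ φ : K →+* ℂ, φ.comp j = τ
  swap
  · push Not at hτ
    have h1 : {φ : K →+* ℂ | φ.comp j = τ ∧ φ ∈ Φ.1} = ∅ :=
      Set.eq_empty_of_forall_notMem fun φ hφ => hτ φ hφ.1
    have h2 : {φ : K →+* ℂ | φ.comp j = τ ∧ φ ∉ Φ.1} = ∅ :=
      Set.eq_empty_of_forall_notMem fun φ hφ => hτ φ hφ.1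
    rw [h1, h2]
  obtain ⟨φ₁, hφ₁⟩ := hτ
  obtain ⟨g₁, rfl⟩ := (embOf_bijective φ₀).2 φ₁
  -- the type read on the Galois group, and the group-level Weil type
  set SG : Finset (K ≃ₐ[ℚ] K) := Finset.univ.filter fun g => embOf φ₀ g ∈ Φ.1 with hSGdef
  have hcm : IsCMTypeWith ρ (SG : Set (K ≃ₐ[ℚ] K)) := by
    have h1 := isCMTypeWith_gal hcomm Φ φ₀ ρ hρ
    have hset : ({g : K ≃ₐ[ℚ] K | embOf φ₀ g ∈ Φ.1} : Set (K ≃ₐ[ℚ] K)) = ↑SG := by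
      ext g; simp [hSGdef]
    rwa [hset] at h1
  have hW := hcm.two_mul_card_filter_char_eq hodd hχ hvan g₁
  -- the fibre over `τ` is the coset `g₁H`, read through `χ`
  have key : ∀ g : K ≃ₐ[ℚ] K, (embOf φ₀ g).comp j = τ ↔ χ (Additive.ofMul g) = χ (Additive.ofMul g₁) := by
    intro g
    rw [← hφ₁]
    exact embOf_comp_algebraMap_fixedField_eq_iff_char_eq φ₀ H hH g g₁
  have hA : {φ : K →+* ℂ | φ.comp j = τ ∧ φ ∈ Φ.1} =
      ↑((SG.filter fun g => χ (Additive.ofMul g) = χ (Additive.ofMul g₁)).image (embOf φ₀)) := by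
    ext φ
    simp only [Set.mem_setOf_eq, Finset.coe_image, Finset.coe_filter, Set.mem_image, hSGdef,
      Finset.mem_filter, Finset.mem_univ, true_and]
    constructor
    · rintro ⟨hφτ, hφΦ⟩
      obtain ⟨g, rfl⟩ := (embOf_bijective φ₀).2 φ
      exact ⟨g, ⟨hφΦ, (key g).1 hφτ⟩, rfl⟩
    · rintro ⟨g, ⟨hgΦ, hg⟩, rfl⟩
      exact ⟨(key g).2 hg, hgΦ⟩
  have hB : {φ : K →+* ℂ | φ.comp j = τ ∧ φ ∉ Φ.1} =
      ↑((Finset.univ.filter fun g : K ≃ₐ[ℚ] K =>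
          χ (Additive.ofMul g) = χ (Additive.ofMul g₁) ∧ g ∉ SG).image (embOf φ₀)) := by
    ext φ
    simp only [Set.mem_setOf_eq, Finset.coe_image, Finset.coe_filter, Set.mem_image, hSGdef,
      Finset.mem_filter, Finset.mem_univ, true_and]
    constructor
    · rintro ⟨hφτ, hφΦ⟩
      obtain ⟨g, rfl⟩ := (embOf_bijective φ₀).2 φ
      exact ⟨g, ⟨(key g).1 hφτ, hφΦ⟩, rfl⟩
    · rintro ⟨g, ⟨hg, hgΦ⟩, rfl⟩
      exact ⟨(key g).2 hg, hgΦ⟩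
  rw [hA, hB, Set.ncard_coe_finset, Set.ncard_coe_finset,
    Finset.card_image_of_injective _ (embOf_bijective φ₀).1,
    Finset.card_image_of_injective _ (embOf_bijective φ₀).1]
  -- `#{g | χ g = v} = #{g ∈ SG | χ g = v} + #{g ∉ SG | χ g = v}` and `2·#{g ∈ SG | χ g = v} = #{g | χ g = v}`
  have hsplit : (Finset.univ.filter fun g : K ≃ₐ[ℚ] K => χ (Additive.ofMul g) = χ (Additive.ofMul g₁)).card =
      (SG.filter fun g => χ (Additive.ofMul g) = χ (Additive.ofMul g₁)).card +
        (Finset.univ.filter fun g : K ≃ₐ[ℚ] K =>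
          χ (Additive.ofMul g) = χ (Additive.ofMul g₁) ∧ g ∉ SG).card := by
    rw [← Finset.card_filter_add_card_filter_not (fun g => g ∈ SG), Finset.filter_filter, Finset.filter_filter]
    congr 1
    have : (Finset.univ.filter fun g : K ≃ₐ[ℚ] K => χ (Additive.ofMul g) = χ (Additive.ofMul g₁) ∧ g ∈ SG) =
        SG.filter fun g => χ (Additive.ofMul g) = χ (Additive.ofMul g₁) := by
      ext g; simp [and_comm]
    rw [this]
  omega

omit [Normal ℚ K] in
/-- **"`k` is a PROPER subfield of `K`"**: `K^{ker χ} ≠ K` ("If `H` is trivial (i.e. `k = K`) … this is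
impossible"). [cite: Yanai2015IndexDegeneracy, Thm. 4.1 (proof, p. 818)] -/
theorem fixedField_ne_top_of_oddCharacter_pow_two_pow
    (hcomm : ∀ g h : K ≃ₐ[ℚ] K, g * h = h * g) (Φ : CMType K) (φ₀ : K →+* ℂ) (ρ : K ≃ₐ[ℚ] K)
    (hρ : ∀ x, φ₀ (ρ x) = starRingEnd ℂ (φ₀ x)) {χ : AddChar (Additive (K ≃ₐ[ℚ] K)) ℂ} {s : ℕ}
    (hodd : χ (Additive.ofMul ρ) = -1) (hχ : ∀ g : K ≃ₐ[ℚ] K, χ (Additive.ofMul g) ^ 2 ^ s = 1)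
    (hvan : ∑ g ∈ Finset.univ.filter (fun g : K ≃ₐ[ℚ] K => embOf φ₀ g ∈ Φ.1), χ (Additive.ofMul g) = 0)
    (H : Subgroup (K ≃ₐ[ℚ] K)) (hH : ∀ g, g ∈ H ↔ χ (Additive.ofMul g) = 1) :
    IntermediateField.fixedField H ≠ ⊤ := by
  letI : CommGroup (K ≃ₐ[ℚ] K) := { (inferInstance : Group (K ≃ₐ[ℚ] K)) with mul_comm := hcomm }
  have hcm : IsCMTypeWith ρ
      ((Finset.univ.filter fun g : K ≃ₐ[ℚ] K => embOf φ₀ g ∈ Φ.1) : Set (K ≃ₐ[ℚ] K)) := by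
    have h1 := isCMTypeWith_gal hcomm Φ φ₀ ρ hρ
    have hset : ({g : K ≃ₐ[ℚ] K | embOf φ₀ g ∈ Φ.1} : Set (K ≃ₐ[ℚ] K)) =
        ↑(Finset.univ.filter fun g : K ≃ₐ[ℚ] K => embOf φ₀ g ∈ Φ.1) := by
      ext g; simp
    rwa [hset] at h1
  obtain ⟨y, hy1, hy⟩ := hcm.exists_ne_one_char_eq_one hodd hχ hvan
  intro htop
  have hbot : H = ⊥ := by
    rw [← IntermediateField.fixingSubgroup_fixedField H, htop, IntermediateField.fixingSubgroup_top]
  have hyH : y ∈ H := (hH y).2 hy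
  rw [hbot] at hyH
  exact hy1 (Subgroup.mem_bot.1 hyH)

omit [Normal ℚ K] in
/-- **`[K : k] = #ker χ` is even** (`k = K^{ker χ}`; `2·n_0 = #H`). [cite: Yanai2015IndexDegeneracy, Thm. 4.1 (proof, p. 818)] -/
theorem two_dvd_finrank_fixedField_of_oddCharacter_pow_two_pow
    (hcomm : ∀ g h : K ≃ₐ[ℚ] K, g * h = h * g) (Φ : CMType K) (φ₀ : K →+* ℂ) (ρ : K ≃ₐ[ℚ] K)
    (hρ : ∀ x, φ₀ (ρ x) = starRingEnd ℂ (φ₀ x)) {χ : AddChar (Additive (K ≃ₐ[ℚ] K)) ℂ} {s : ℕ}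
    (hodd : χ (Additive.ofMul ρ) = -1) (hχ : ∀ g : K ≃ₐ[ℚ] K, χ (Additive.ofMul g) ^ 2 ^ s = 1)
    (hvan : ∑ g ∈ Finset.univ.filter (fun g : K ≃ₐ[ℚ] K => embOf φ₀ g ∈ Φ.1), χ (Additive.ofMul g) = 0)
    (H : Subgroup (K ≃ₐ[ℚ] K)) (hH : ∀ g, g ∈ H ↔ χ (Additive.ofMul g) = 1) :
    2 ∣ Module.finrank (IntermediateField.fixedField H) K := by
  letI : CommGroup (K ≃ₐ[ℚ] K) := { (inferInstance : Group (K ≃ₐ[ℚ] K)) with mul_comm := hcomm }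
  have hcm : IsCMTypeWith ρ
      ((Finset.univ.filter fun g : K ≃ₐ[ℚ] K => embOf φ₀ g ∈ Φ.1) : Set (K ≃ₐ[ℚ] K)) := by
    have h1 := isCMTypeWith_gal hcomm Φ φ₀ ρ hρ
    have hset : ({g : K ≃ₐ[ℚ] K | embOf φ₀ g ∈ Φ.1} : Set (K ≃ₐ[ℚ] K)) =
        ↑(Finset.univ.filter fun g : K ≃ₐ[ℚ] K => embOf φ₀ g ∈ Φ.1) := by
      ext g; simp
    rwa [hset] at h1
  have h2 := hcm.two_dvd_card_ker_char hodd hχ hvan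
  rw [IntermediateField.finrank_fixedField_eq_card, Nat.card_eq_fintype_card, Fintype.card_subtype]
  have hset : (Finset.univ.filter fun g : K ≃ₐ[ℚ] K => g ∈ H) =
      Finset.univ.filter fun g : K ≃ₐ[ℚ] K => χ (Additive.ofMul g) = 1 := by
    ext g; simp [hH]
  rw [hset]
  exact h2

omit [Normal ℚ K] in
/-- **"`k` is a CM subfield": complex conjugation is non-trivial on `k = K^{ker χ}`** — the place `φ₀|_k` of `k` is
not real (`\overline{φ₀|_k} = φ₀|_k` would put `ρ` in `fixingSubgroup k = H`, but `χ(ρ) = −1`).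
[cite: Yanai2015IndexDegeneracy, Thm. 4.1 (proof, p. 818)] -/
theorem conjugate_comp_algebraMap_fixedField_ne (φ₀ : K →+* ℂ) (ρ : K ≃ₐ[ℚ] K)
    (hρ : ∀ x, φ₀ (ρ x) = starRingEnd ℂ (φ₀ x)) {χ : AddChar (Additive (K ≃ₐ[ℚ] K)) ℂ}
    (hodd : χ (Additive.ofMul ρ) = -1) (H : Subgroup (K ≃ₐ[ℚ] K))
    (hH : ∀ g, g ∈ H ↔ χ (Additive.ofMul g) = 1) :
    ComplexEmbedding.conjugate (φ₀.comp (algebraMap (IntermediateField.fixedField H) K)) ≠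
      φ₀.comp (algebraMap (IntermediateField.fixedField H) K) := by
  intro heq
  have hρH : ρ ∈ H := by
    rw [← IntermediateField.fixingSubgroup_fixedField H, IntermediateField.mem_fixingSubgroup_iff]
    intro x hx
    have h1 := RingHom.congr_fun heq ⟨x, hx⟩
    rw [ComplexEmbedding.conjugate_coe_eq] at h1
    simp only [RingHom.comp_apply, IntermediateField.algebraMap_apply] at h1
    -- `h1 : conj (φ₀ x) = φ₀ x`, and `conj (φ₀ x) = φ₀ (ρ x)`
    rw [← hρ] at h1
    exact φ₀.injective h1
  have h1 : χ (Additive.ofMul ρ) = 1 := (hH ρ).1 hρH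
  rw [hodd] at h1
  norm_num at h1

variable [IsCMField K]

/-- **`(K; Φ)` is DEGENERATE** under the hypotheses of Theorem 4.1 (Weil type over a subfield with a complex place;
equally Kubota's Lemma 2 for any odd vanishing character). [cite: Yanai2015IndexDegeneracy, Thm. 4.1 and §1 (iii)] -/
theorem not_isNondegenerate_of_oddCharacter_pow_two_pow
    (hcomm : ∀ g h : K ≃ₐ[ℚ] K, g * h = h * g) (Φ : CMType K) (φ₀ : K →+* ℂ) (ρ : K ≃ₐ[ℚ] K)
    (hρ : ∀ x, φ₀ (ρ x) = starRingEnd ℂ (φ₀ x)) {χ : AddChar (Additive (K ≃ₐ[ℚ] K)) ℂ} {s : ℕ}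
    (hodd : χ (Additive.ofMul ρ) = -1) (hχ : ∀ g : K ≃ₐ[ℚ] K, χ (Additive.ofMul g) ^ 2 ^ s = 1)
    (hvan : ∑ g ∈ Finset.univ.filter (fun g : K ≃ₐ[ℚ] K => embOf φ₀ g ∈ Φ.1), χ (Additive.ofMul g) = 0)
    (H : Subgroup (K ≃ₐ[ℚ] K)) (hH : ∀ g, g ∈ H ↔ χ (Additive.ofMul g) = 1) : ¬IsNondegenerate Φ :=
  not_isNondegenerate_of_fibres_balanced (algebraMap (IntermediateField.fixedField H) K)
    (fibres_balanced_fixedField_of_oddCharacter_pow_two_pow hcomm Φ φ₀ ρ hρ hodd hχ hvan H hH)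
    (conjugate_comp_algebraMap_fixedField_ne φ₀ ρ hρ hodd H hH)

variable {A : AbelianVariety ℂ} {ι : 𝓞 K →+* End A} {θ : K →+* Module.End ℂ (complexBetti A.X 1)}

/-- **THEOREM 4.1 (Yanai 2015) — "the index of degeneracy of `A` is equal to `1`".**  Let `K` be an abelian CM field
(normal over `ℚ`, commutative Galois group), `Φ` a PRIMITIVE CM type of `K` (`A` simple, Yanai §3) and `χ` an odd
character of `Gal(K/ℚ)` of 2-power order vanishing on `{g | σ_g ∈ Φ}`, `H = ker χ`, `k = K^H`.  Then EVERY abelian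
variety `(A, ι, θ)` of CM type `(K; Φ)` carries a rational class of Hodge type `(m, m)`, `2m = [K : k] = #H`, which
does NOT lie in `Dᵐ(A) ⊗ ℂ` — the Weil class of `(A, k)`, "an exceptional Hodge cycle of codimension `r/2`"; in
particular the index of degeneracy of `A` is `1`. [cite: Yanai2015IndexDegeneracy, Thm. 4.1 and §2 (p. 817)]
[cite: Gordon1999HodgeAVSurvey, 9.2.2 and 5.13 (ii)] -/
theorem exists_exceptional_of_oddCharacter_pow_two_pow
    (hcomm : ∀ g h : K ≃ₐ[ℚ] K, g * h = h * g) {Φ : CMType K} (φ₀ : K →+* ℂ) (ρ : K ≃ₐ[ℚ] K)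
    (hρ : ∀ x, φ₀ (ρ x) = starRingEnd ℂ (φ₀ x)) {χ : AddChar (Additive (K ≃ₐ[ℚ] K)) ℂ} {s : ℕ}
    (hodd : χ (Additive.ofMul ρ) = -1) (hχ : ∀ g : K ≃ₐ[ℚ] K, χ (Additive.ofMul g) ^ 2 ^ s = 1)
    (hvan : ∑ g ∈ Finset.univ.filter (fun g : K ≃ₐ[ℚ] K => embOf φ₀ g ∈ Φ.1), χ (Additive.ofMul g) = 0)
    (H : Subgroup (K ≃ₐ[ℚ] K)) (hH : ∀ g, g ∈ H ↔ χ (Additive.ofMul g) = 1)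
    (hprim : IsPrimitive (ℂ ≃+* ℂ) Φ.1 φ₀) (hA : IsCMTypeRealisation Φ A ι θ) :
    ∃ m : ℕ, (Finset.univ.filter fun φ : K →+* ℂ =>
        φ.comp (algebraMap (IntermediateField.fixedField H) K) =
          φ₀.comp (algebraMap (IntermediateField.fixedField H) K)).card = 2 * m ∧
      ∃ c : complexBetti A.X (2 * m), IsRationalClass c ∧
        IsOfHodgeType (Module.finrank ℚ K / 2) A.X (2 * m) m m c ∧
        c ∉ divisorClassesSpan A.X (Module.finrank ℚ K / 2) m :=
  exists_exceptional_of_fibres_balanced' (algebraMap (IntermediateField.fixedField H) K) φ₀ hprim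
    (fibres_balanced_fixedField_of_oddCharacter_pow_two_pow hcomm Φ φ₀ ρ hρ hodd hχ hvan H hH)
    (conjugate_comp_algebraMap_fixedField_ne φ₀ ρ hρ hodd H hH) hA

omit [IsCMField K] in
/-- **The codimension is `r/2`, `r = #H = [K : k]`**: the fibre of `Hom(K, ℂ) → Hom(k, ℂ)` over `φ₀|_k` is
`{σ_g | g ∈ H}`, of size `#H`. [cite: Yanai2015IndexDegeneracy, §2 (p. 817) and Thm. 4.1] -/
theorem card_fibre_algebraMap_fixedField_eq (φ₀ : K →+* ℂ) {χ : AddChar (Additive (K ≃ₐ[ℚ] K)) ℂ}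
    (H : Subgroup (K ≃ₐ[ℚ] K)) (hH : ∀ g, g ∈ H ↔ χ (Additive.ofMul g) = 1) :
    (Finset.univ.filter fun φ : K →+* ℂ =>
        φ.comp (algebraMap (IntermediateField.fixedField H) K) =
          φ₀.comp (algebraMap (IntermediateField.fixedField H) K)).card = Nat.card H := by
  have hφ₀ : embOf φ₀ 1 = φ₀ := by
    refine RingHom.ext fun x => ?_
    rw [embOf_apply]
    rfl
  have hset : (Finset.univ.filter fun φ : K →+* ℂ =>
      φ.comp (algebraMap (IntermediateField.fixedField H) K) =
        φ₀.comp (algebraMap (IntermediateField.fixedField H) K)) =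
      (Finset.univ.filter fun g : K ≃ₐ[ℚ] K => g ∈ H).image (embOf φ₀) := by
    ext φ
    simp only [Finset.mem_filter, Finset.mem_univ, true_and, Finset.mem_image]
    constructor
    · intro hφ
      obtain ⟨g, rfl⟩ := (embOf_bijective φ₀).2 φ
      refine ⟨g, ?_, rfl⟩
      rw [hH, ← AddChar.map_zero_eq_one χ, ← ofMul_one,
        ← embOf_comp_algebraMap_fixedField_eq_iff_char_eq φ₀ H hH g 1, hφ₀]
      exact hφ
    · rintro ⟨g, hg, rfl⟩
      have h1 := (embOf_comp_algebraMap_fixedField_eq_iff_char_eq φ₀ H hH g 1).2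
        (by rw [(hH g).1 hg, ofMul_one, AddChar.map_zero_eq_one])
      rwa [hφ₀] at h1
  rw [hset, Finset.card_image_of_injective _ (embOf_bijective φ₀).1, Nat.card_eq_fintype_card,
    Fintype.card_subtype]

end Yanai

end Literature.AlgebraicGeometry.Pohlmann1968
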